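import Summits.CriticalPhenomena.PercolationContinuityZ3.Theorems.PercNearOneGluingNoHeavyLowerTailSunflowerMatroidPartition
import HarnessLib
import HarnessLib.Audit

/-!
# `NoHeavyLowerTail` (crux stmt-CriticalPhenomena-4575), abstract sunflower cubic: the ORDER-FREE RAINBOW DICHOTOMY —
# a canonical, order-free sufficient condition for the rainbow matroid partition (`RainbowMatroidPartition`), hence for ★

Support file (seat `prim-l12-p2` gen 22; `--supports stmt-CriticalPhenomena-4575`).  No `sorry`.  New definitions: the strict product
order `RbBelow` on rainbows, the two restricted two-stage vectors `Sunflower.tsB` / `Sunflower.tsA`, the rainbow set `Sunflower.rainbows`,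
the two dependence predicates `Sunflower.DepB` / `Sunflower.DepA`, and the `@[conjecture]` `RainbowDichotomy` (an obligation of this
programme — census-true, unproved —, never a fact).
Memo: run/shared/lean/prim/prim-l12/prim-l12-p2/FINDING-g22-RAINBOW-DICHOTOMY.md.

SETTING (gens 18–21: `…SunflowerRainbowVectors`, `…Reduction`, `…MatroidPartition`).  A rainbow is `ρ = (Q1,Q2,Q3)` (`ρ.1 = Q1`, `ρ.2 = Q2`,
`Q3 = (Q1 ∪ Q2)ᶜ`); its two-stage vector `rbVec ρ` splits as `TS-B_ρ` (restriction to the bottom-spectator supplies, `tsB`) `+ TS-A_ρ`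
(kernel-spectator supplies, `tsA`).  `RainbowMatroidPartition` (MP, gen 21) asks for a split of the rainbows into `R_B ⊔ R_A` with
`{TS-B_ρ}_{R_B}` and `{TS-A_ρ}_{R_A}` linearly independent over `GF(2)`; MP ⟹ ★ (`partitionLemmaH_of_rainbowMatroidPartition`).

THE ORDER.  `RbBelow ρ' ρ` ("`ρ'` strictly below `ρ`"): `Q1' ⊆ Q1` and `Q3' ⊆ Q3` (hence `Q2' ⊇ Q2`), not both equal.

THE DICHOTOMY (this work, `RainbowDichotomy`, (ZZ) in the memo): for every sunflower and every rainbow `ρ`, NOT BOTH of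
* `DepB ρ`: `TS-B_ρ ∈ span {TS-B_ρ' : ρ' ≠ ρ a rainbow NOT strictly above ρ}`,
* `DepA ρ`: `TS-A_ρ ∈ span {TS-A_ρ' : ρ' ≠ ρ a rainbow NOT strictly below ρ}`.
It is ORDER-FREE and CANONICAL (no greedy basis, no tie-breaking weights — cf. gen 21's MP-GREEDY), and it is exactly the existence, for
each `ρ`, of a functional `(λ | κ)` with `λ ⊥ TS-B(not above ρ)`, `κ ⊥ TS-A(not below ρ)` and `⟨λ,TS-B_ρ⟩ + ⟨κ,TS-A_ρ⟩ = 1`.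
CENSUS (gen 22, code `code/zz.c`; kit j138306, evidence `compute-j138306.json` on the crux item): 0 exceptions on ALL 275 665 902 monotone maps
`2^5 → M₃` (2 890 800 with rainbows, 3 391 320 rainbows), 199 128 compositions `θ∘gadgets` on ≤ 6 points, the cyclic star `CS(3,3,3)` on 9 points
(216 of its 217 rainbows are `DepB`; `KA = 216`) with 39 relabelled neighbours and 55 perturbations, 672 320 random + 640 000 all-petals-non-
intersecting sunflowers on 6 points, 228 179 on 7, 21 133 on 8, 1 288 on 9 points (≈ 1.4·10⁷ rainbows).  The single-coordinate orders (`Q1' ⊆ Q1`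
only, `Q3' ⊆ Q3` only), the swapped assignment (B vs not-below, A vs not-above) and the order-free dichotomy without any order all FAIL; the
column-private version of `¬DepA` fails in rare instances (n = 7) where `TS-A_ρ` is a unit vector — the span form is needed.

* `RbBelow.weight_lt` — strictly below ⟹ `|Q1'| + |Q3'| < |Q1| + |Q3|`.
* `linearIndependent_of_not_mem_span_adm` — generic "leading term" lemma over a field: if every `v i` (`i ∈ s`) lies outside the span of the
  `v j` with `j` ADMISSIBLE for `i`, and every non-admissible `j ≠ i` has strictly larger weight, then `{v i}_{i ∈ s}` is linearly independent
  (a dependency's maximal-weight member would lie in the span of admissible ones).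
* **`rainbowMatroidPartition_of_rainbowDichotomy`** : (ZZ) ⟹ MP, with the CANONICAL split `R_A := {ρ : DepB ρ}`, `R_B :=` the rest
  (B-side: weight `|Q1|+|Q3|`, admissible = not strictly above; A-side: weight `2|α| − |Q1| − |Q3|`, admissible = not strictly below).
* **`partitionLemmaH_of_rainbowDichotomy`** : (ZZ) ⟹ ★ (`PartitionLemmaH`).
-/

namespace Summit.CriticalPhenomena.PercolationContinuityZ3.Theorems.SunflowerPartition

open Finset

/-! ## A generic leading-term criterion for linear independence -/

/-- **Leading-term criterion** (this work).  Let `v : ι → M` over a field, `s` a finite index set, `w` a weight and `adm i j` a relation such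
that every `j ∈ s`, `j ≠ i`, that is NOT admissible for `i` has `w i < w j`.  If no `v i` (`i ∈ s`) lies in the span of `{v j : j ∈ s, j ≠ i, adm i j}`,
then `{v i}_{i ∈ s}` is linearly independent: in a non-trivial dependency the member of maximal weight is a combination of the others, all of
which are admissible for it. [this work] -/
theorem linearIndependent_of_not_mem_span_adm {K : Type*} [Field K] {M : Type*} [AddCommGroup M] [Module K M] {ι : Type*}
    (s : Finset ι) (v : ι → M) (w : ι → ℕ) (adm : ι → ι → Prop)
    (hadm : ∀ i ∈ s, ∀ j ∈ s, j ≠ i → ¬ adm i j → w i < w j)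
    (h : ∀ i ∈ s, v i ∉ Submodule.span K (v '' {j | j ∈ s ∧ j ≠ i ∧ adm i j})) :
    LinearIndependent K (fun i : ↥s => v (i : ι)) := by
  classical
  rw [Fintype.linearIndependent_iff]
  intro g hg
  by_contra hne
  push Not at hne
  obtain ⟨i₁, hi₁⟩ := hne
  set T := (Finset.univ : Finset ↥s).filter (fun i => g i ≠ 0) with hT
  have hTne : T.Nonempty := ⟨i₁, by rw [hT, Finset.mem_filter]; exact ⟨Finset.mem_univ _, hi₁⟩⟩
  obtain ⟨i₀, hi₀T, hmax⟩ := Finset.exists_max_image T (fun i => w (i : ι)) hTne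
  have hg0 : g i₀ ≠ 0 := (Finset.mem_filter.1 hi₀T).2
  have hsum : g i₀ • v i₀ + ∑ j ∈ (Finset.univ : Finset ↥s).erase i₀, g j • v j = 0 := by
    rw [Finset.add_sum_erase _ (fun j => g j • v (j : ι)) (Finset.mem_univ i₀)]
    exact hg
  have hvi : v i₀ = (-(g i₀)⁻¹) • ∑ j ∈ (Finset.univ : Finset ↥s).erase i₀, g j • v j := by
    have h1 : g i₀ • v (i₀ : ι) = -∑ j ∈ (Finset.univ : Finset ↥s).erase i₀, g j • v j :=
      eq_neg_of_add_eq_zero_left hsum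
    calc v (i₀ : ι) = (g i₀)⁻¹ • (g i₀ • v (i₀ : ι)) := by rw [smul_smul, inv_mul_cancel₀ hg0, one_smul]
      _ = (-(g i₀)⁻¹) • ∑ j ∈ (Finset.univ : Finset ↥s).erase i₀, g j • v j := by rw [h1, smul_neg, neg_smul]
  apply h i₀ i₀.2
  rw [hvi]
  refine Submodule.smul_mem _ _ (Submodule.sum_mem _ fun j hj => ?_)
  by_cases hgj : g j = 0
  · rw [hgj, zero_smul]; exact Submodule.zero_mem _
  · have hji : (j : ι) ≠ (i₀ : ι) := fun heq => (Finset.mem_erase.1 hj).1 (Subtype.ext heq)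
    refine Submodule.smul_mem _ _ (Submodule.subset_span ⟨(j : ι), ⟨j.2, hji, ?_⟩, rfl⟩)
    by_contra hadm'
    have hlt := hadm i₀ i₀.2 j j.2 hji hadm'
    have hle := hmax j (Finset.mem_filter.2 ⟨Finset.mem_univ _, hgj⟩)
    exact absurd hle (not_le.2 hlt)

/-! ## The strict product order on rainbows -/

variable {α : Type*} [Fintype α] [DecidableEq α]

/-- `RbBelow ρ' ρ`: the rainbow `ρ' = (Q1',Q2',Q3')` is STRICTLY BELOW `ρ = (Q1,Q2,Q3)`: `Q1' ⊆ Q1`, `Q3' ⊆ Q3`, not both equal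
(third blocks `Q3 = (Q1 ∪ Q2)ᶜ`). [this work] -/
def RbBelow (ρ' ρ : Finset α × Finset α) : Prop :=
  ρ'.1 ⊆ ρ.1 ∧ (ρ'.1 ∪ ρ'.2)ᶜ ⊆ (ρ.1 ∪ ρ.2)ᶜ ∧ (ρ'.1 ≠ ρ.1 ∨ (ρ'.1 ∪ ρ'.2)ᶜ ≠ (ρ.1 ∪ ρ.2)ᶜ)

/-- The weight `|Q1| + |Q3|` strictly increases along `RbBelow`. [this work] -/
theorem RbBelow.weight_lt {ρ' ρ : Finset α × Finset α} (h : RbBelow ρ' ρ) :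
    ρ'.1.card + ((ρ'.1 ∪ ρ'.2)ᶜ).card < ρ.1.card + ((ρ.1 ∪ ρ.2)ᶜ).card := by
  obtain ⟨h1, h3, hne⟩ := h
  rcases hne with hne | hne
  · exact Nat.add_lt_add_of_lt_of_le (Finset.card_lt_card (Finset.ssubset_iff_subset_ne.2 ⟨h1, hne⟩)) (Finset.card_le_card h3)
  · exact Nat.add_lt_add_of_le_of_lt (Finset.card_le_card h1) (Finset.card_lt_card (Finset.ssubset_iff_subset_ne.2 ⟨h3, hne⟩))

/-- The weight is at most `2 |α|`. [this work] -/
theorem weight_le_two_card (ρ : Finset α × Finset α) :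
    ρ.1.card + ((ρ.1 ∪ ρ.2)ᶜ).card ≤ 2 * Fintype.card α := by
  have h1 : ρ.1.card ≤ Fintype.card α := Finset.card_le_univ _
  have h2 : ((ρ.1 ∪ ρ.2)ᶜ).card ≤ Fintype.card α := Finset.card_le_univ _
  omega

namespace Sunflower

variable (F : Sunflower α)

/-- The rainbows of `F` (demands with word `(1,2,3)`). [this work] -/
def rainbows : Finset (Finset α × Finset α) := F.dem.filter (fun d => F.IsRainbow d)

/-- `TS-B_ρ`: the two-stage vector restricted to the BOTTOM-spectator supplies. [this work] -/
def tsB (ρ : Finset α × Finset α) : ↥(F.sup.filter (fun σ => F.lab σ.2 = 0)) → ZMod 2 := fun σ => F.rbVec ρ σ.1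

/-- `TS-A_ρ`: the two-stage vector restricted to the KERNEL-spectator supplies. [this work] -/
def tsA (ρ : Finset α × Finset α) : ↥(F.sup.filter (fun σ => F.lab σ.2 = 4)) → ZMod 2 := fun σ => F.rbVec ρ σ.1

/-- `DepB ρ`: `TS-B_ρ` lies in the span of the `TS-B_ρ'`, `ρ' ≠ ρ` a rainbow NOT strictly above `ρ`. [this work] -/
def DepB (ρ : Finset α × Finset α) : Prop :=
  F.tsB ρ ∈ Submodule.span (ZMod 2) (F.tsB '' {ρ' | ρ' ∈ F.rainbows ∧ ρ' ≠ ρ ∧ ¬ RbBelow ρ ρ'})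

/-- `DepA ρ`: `TS-A_ρ` lies in the span of the `TS-A_ρ'`, `ρ' ≠ ρ` a rainbow NOT strictly below `ρ`. [this work] -/
def DepA (ρ : Finset α × Finset α) : Prop :=
  F.tsA ρ ∈ Submodule.span (ZMod 2) (F.tsA '' {ρ' | ρ' ∈ F.rainbows ∧ ρ' ≠ ρ ∧ ¬ RbBelow ρ' ρ})

end Sunflower

/-! ## The typed conjecture and the reduction -/

/-- **ORDER-FREE RAINBOW DICHOTOMY (ZZ)** (this work; OPEN, census-clean — file header): no rainbow of a sunflower is both `DepB` (its `TS-B`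
part depends on the `TS-B` parts of the rainbows not strictly above it) and `DepA` (its `TS-A` part depends on the `TS-A` parts of the rainbows
not strictly below it).  Implies `RainbowMatroidPartition`, hence ★.  An obligation, never a fact: use as `(h : RainbowDichotomy)`. [status: open] -/
@[conjecture] def RainbowDichotomy : Prop :=
  ∀ (α : Type) [Fintype α] [DecidableEq α] (F : Sunflower α), ∀ ρ ∈ F.rainbows, ¬ (F.DepB ρ ∧ F.DepA ρ)

/-- **(ZZ) ⟹ MP** (this work): the canonical split `R_A := {ρ : DepB ρ}`, `R_B :=` the other rainbows is a rainbow matroid partition.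
B-side: a dependency among `{TS-B_ρ}_{R_B}` has a member of maximal weight `|Q1|+|Q3|`; all other members are not strictly above it, so it is
`DepB` — contradiction.  A-side: a member of minimal weight is `DepA`, but it is also `DepB` — excluded by (ZZ). [this work] -/
theorem rainbowMatroidPartition_of_rainbowDichotomy (h : RainbowDichotomy) : RainbowMatroidPartition := by
  intro α _ _ F
  classical
  refine ⟨F.rainbows.filter (fun ρ => ¬ F.DepB ρ), F.rainbows.filter (fun ρ => F.DepB ρ), ?_, ?_, ?_, ?_, ?_, ?_⟩
  · exact Finset.filter_subset _ _
  · exact Finset.filter_subset _ _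
  · exact Finset.disjoint_filter.2 fun _ _ h1 h2 => h1 h2
  · rw [← Finset.filter_or]
    unfold Sunflower.rainbows
    ext ρ
    simp only [Finset.mem_filter]
    tauto
  · -- B-side: weight |Q1| + |Q3|, admissible = not strictly above
    have key := linearIndependent_of_not_mem_span_adm (K := ZMod 2) (F.rainbows.filter (fun ρ => ¬ F.DepB ρ)) F.tsB
      (fun ρ => ρ.1.card + ((ρ.1 ∪ ρ.2)ᶜ).card) (fun ρ ρ' => ¬ RbBelow ρ ρ') ?_ ?_
    · exact key
    · intro i _ j _ _ hadm
      rw [not_not] at hadm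
      exact RbBelow.weight_lt hadm
    · intro i hi hmem
      have hnot : ¬ F.DepB i := (Finset.mem_filter.1 hi).2
      apply hnot
      unfold Sunflower.DepB
      refine Submodule.span_mono (Set.image_mono ?_) hmem
      intro j hj
      exact ⟨(Finset.mem_filter.1 hj.1).1, hj.2.1, hj.2.2⟩
  · -- A-side: weight 2|α| − (|Q1| + |Q3|), admissible = not strictly below
    have key := linearIndependent_of_not_mem_span_adm (K := ZMod 2) (F.rainbows.filter (fun ρ => F.DepB ρ)) F.tsA
      (fun ρ => 2 * Fintype.card α - (ρ.1.card + ((ρ.1 ∪ ρ.2)ᶜ).card)) (fun ρ ρ' => ¬ RbBelow ρ' ρ) ?_ ?_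
    · exact key
    · intro i _ j _ _ hadm
      rw [not_not] at hadm
      have hlt := RbBelow.weight_lt hadm
      have hi := weight_le_two_card (α := α) i
      have hj := weight_le_two_card (α := α) j
      omega
    · intro i hi hmem
      have hdepB : F.DepB i := (Finset.mem_filter.1 hi).2
      have hnotA : ¬ F.DepA i := fun hA => h α F i (Finset.mem_filter.1 hi).1 ⟨hdepB, hA⟩
      apply hnotA
      unfold Sunflower.DepA
      refine Submodule.span_mono (Set.image_mono ?_) hmem
      intro j hj
      exact ⟨(Finset.mem_filter.1 hj.1).1, hj.2.1, hj.2.2⟩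

/-- **(ZZ) ⟹ ★** (this work). [this work] -/
theorem partitionLemmaH_of_rainbowDichotomy (h : RainbowDichotomy) : PartitionLemmaH :=
  partitionLemmaH_of_rainbowMatroidPartition (rainbowMatroidPartition_of_rainbowDichotomy h)

end Summit.CriticalPhenomena.PercolationContinuityZ3.Theorems.SunflowerPartition
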